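import Summits.CriticalPhenomena.PercolationContinuityZ3.Theorems.Transplant.SkelPhiConcSchedule
import Summits.CriticalPhenomena.PercolationContinuityZ3.Theorems.Transplant.SkelConcRootRadii
import HarnessLib

/-!
# D″ node, (R) layer (R-RECUT-PLAN §1 row 3): the ROOT RADIUS FACTS of the two-unit schedule of record `Skelφ.concRadii2S P gap gap' E₀ L'`
# (p2-g7's `SkelPhiConcSchedule`; stmt-g9's `Skelφ.Prm.sched S P = concRadii2S P (gap S) 0 (E₀ S) (Lp S)`) — the `hRB/hRQ/hRM/hQE` hypotheses
# of the (R) assembly (`Skelφ.rootOblT_concSG_sched`, `SkelPhiRootSchedAssembly`) with `Rt := F 1 − L' − 1`, and `rQ 0 0 ≤ E₀ ⊔ 1`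
# — the φ-level / two-unit twin of p2-g5's `Skel.root_radii_concRadiiS(')` (`SkelConcRootRadii`), verbatim up to `off C 0 = 1 ↦ off2 P 0 = 1`

builds on p205010 (kernel theorem, internal audit signed; external expert review pending) — nothing in this file uses p205010.
Status sentence (coordinator 2026-08-20T04:30Z): "θ(p_c) = 0 on ℤ^d, all d ≥ 2 — kernel-verified (Lean 4/Mathlib, standard axioms); internal
adversarial audit SIGNED 2026-08-20 04:29Z; external expert review pending."
Lane `prim-bschramm-*`, seat `prim-bschramm-p2` (gen 8; (R) = p2 lineage under D″); helper file (`--supports stmt-CriticalPhenomena-4575`).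
* `Skelφ.off2_zero` (`off2 P 0 = 1`);
* **`Skelφ.root_radii_concRadii2S`** — `1 ≤ E₀`: `F 1 − L' ≤ rB 0 0 du`, `F 1 − L' ≤ rQ 0 (0+du)`, `F 1 − L' ≤ rM 0 (0+du)`, `rQ 0 0 ≤ E₀`;
* **`Skelφ.root_radii_concRadii2S'`** — the consumer's shape with `Rt := F 1 − L' − 1` (`L' + 1 ≤ F 1`): `Rt + 1 ≤ rB / rQ(0+du) / rM`.
[cite: KozmaNitzan2024, §4 p. 28 ((32) at the root)]
-/

noncomputable section

open scoped Classical

namespace Summit.CriticalPhenomena.PercolationContinuityZ3.Theorems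

namespace Transplant

namespace Skelφ

open Literature.Probability.Percolation Literature.Probability.LatticeModels SimpleGraph
open BoxProdZ2 (ConcRadiiG Erad Frad nQ Frad_le_Erad Erad_zero)
open Skel (nQ_zero_stepVec nQ_zero_zero)

variable (P : PCells2) (gap gap' : ℕ → ℕ) (E₀ L' : ℕ)

/-- `off2 P 0 = 1` (the macro-origin has no planar offset). [folklore] -/
theorem off2_zero : off2 P 0 = 1 := by simp [off2]

/-- **The root radius facts of the two-unit schedule of record** (`1 ≤ E₀`): `F 1 − L' ≤ rB 0 0 du`, `F 1 − L' ≤ rQ 0 (0 + du)`,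
`F 1 − L' ≤ rM 0 (0 + du)` and `rQ 0 0 ≤ E₀`. [cite: KozmaNitzan2024, §4 p. 28] -/
theorem root_radii_concRadii2S (hE₀ : 1 ≤ E₀) (du : MDir) :
    Frad gap gap' E₀ 1 - L' ≤ (concRadii2S P gap gap' E₀ L').rB 0 0 du ∧
      Frad gap gap' E₀ 1 - L' ≤ (concRadii2S P gap gap' E₀ L').rQ 0 ((0 : Site 2) + stepVec du) ∧
      Frad gap gap' E₀ 1 - L' ≤ (concRadii2S P gap gap' E₀ L').rM 0 ((0 : Site 2) + stepVec du) ∧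
      (concRadii2S P gap gap' E₀ L').rQ 0 0 ≤ E₀ := by
  refine ⟨?_, ?_, ?_, ?_⟩
  · rw [concRadii2S_rB, nQ_zero_stepVec]
    exact (Nat.sub_le _ _).trans (Frad_le_Erad gap gap' E₀ 1)
  · rw [concRadii2S_rQ, nQ_zero_stepVec]
    exact le_max_of_le_left ((Nat.sub_le _ _).trans (Frad_le_Erad gap gap' E₀ 1))
  · rw [concRadii2S_rM, nQ_zero_stepVec]
  · rw [concRadii2S_rQ, nQ_zero_zero, Erad_zero, off2_zero]
    exact max_le le_rfl hE₀

/-- **The same in the consumer's shape** (`Skelφ.rootOblT_concSG_sched`): with `Rt := F 1 − L' − 1` and `L' + 1 ≤ F 1`, the three radius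
facts with their unit of slack. [folklore] -/
theorem root_radii_concRadii2S' (hE₀ : 1 ≤ E₀) (hL : L' + 1 ≤ Frad gap gap' E₀ 1) (du : MDir) :
    (Frad gap gap' E₀ 1 - L' - 1) + 1 ≤ (concRadii2S P gap gap' E₀ L').rB 0 0 du ∧
      (Frad gap gap' E₀ 1 - L' - 1) + 1 ≤ (concRadii2S P gap gap' E₀ L').rQ 0 ((0 : Site 2) + stepVec du) ∧
      (Frad gap gap' E₀ 1 - L' - 1) + 1 ≤ (concRadii2S P gap gap' E₀ L').rM 0 ((0 : Site 2) + stepVec du) := by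
  obtain ⟨h1, h2, h3, -⟩ := root_radii_concRadii2S P gap gap' E₀ L' hE₀ du
  have h : Frad gap gap' E₀ 1 - L' - 1 + 1 = Frad gap gap' E₀ 1 - L' := by omega
  rw [h]
  exact ⟨h1, h2, h3⟩

end Skelφ

end Transplant

end Summit.CriticalPhenomena.PercolationContinuityZ3.Theorems

end
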